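/-
HONEST FRAMING: certified error envelopes and provably optimal rounding/accumulation schemes for
low-precision formats under stated cost models; every table by two implementations; no hardware
or vendor claims.
-/
import Summits.Ventures.CertifiedArithmetic.LowPrec.OptDemotionRoutingCoef
import Summits.Ventures.CertifiedArithmetic.LowPrec.OptDemotionRoutingRelabel
import Summits.Ventures.CertifiedArithmetic.LowPrec.OptDemotionRoutingVal

/-!
# The demotion law (Theorem T8), part 8h: MIDPOINT CONVEXITY (MC) of the bit-routing value (opt gen 13 §4)

opt gen 13 (README §4, (MC), proved on paper, 0 violations in 8 482 exact instances at q = 4,5,6):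
for a float `v` and a bit `β ∈ bits(v)` with `v + β` a float, `BR_t(v + β) + BR_t(v - β) ≥ 2 BR_t(v)`.
In exponents: `S = bits(v)` routable, `β ∈ S` with maximal run `β, β+1, …, β+j ∈ S`, `β+j+1 ∉ S`;
`bits(v - β) = S ∖ {β}` and `bits(v + β) = (S ∖ run) ∪ {β+j+1}` (the carry).  THIS FILE proves it
(`treeBR_midconvex`) in the weight framework of parts 8a–8g: take a supporting routing `G` of `S`
(8f); `BR(S ∖ {β}) ≥` its score at the weight `2^e` minus the class of `β` (deletion 8b + locality);
for each run member `b`, `BR((S ∖ run) ∪ {β+j+1}) ≥` its score at the weight that pays the class of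
`b` at the rate of `β+j+1` and nothing on the other run classes (transplant 8g + deletion); choosing
`b` with the best rate `T_b / 2^b` (`T_r` = the score earned by the class of `r`) the two scores add
up to at least twice the score of `G`, because `2^β + Σ_run 2^r = 2^(β+j+1)`; the second bound alone
gives `treeBR_le_carry`: `BR_t(S) ≤ BR_t((S ∖ run) ∪ {β+j+1})` — the carry case (ii) of opt's
MONOTONICITY (M).  (M) and (MC) are the two single-tree facts behind opt's un-carry descent (R19/R20).
-/

namespace Summit.Ventures.CertifiedArithmetic.LowPrec.Opt

open Literature.ComputerArithmetic.JeannerodRump2018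
open Literature.ComputerArithmetic.JeannerodRump2018.SumTree

/-! ## Scores are linear in the weight; class weights -/

/-- The score is additive in the weight. -/
theorem score_add_weight (W₁ W₂ : ℤ → ℚ) (G : ℤ →₀ ℚ) :
    score (fun e => W₁ e + W₂ e) G = score W₁ G + score W₂ G := by
  unfold score
  rw [← Finsupp.sum_add]
  exact Finsupp.sum_congr fun e _ => by ring

/-- The score is homogeneous in the weight. -/
theorem score_smul_weight (c : ℚ) (W : ℤ → ℚ) (G : ℤ →₀ ℚ) :
    score (fun e => c * W e) G = c * score W G := by
  unfold score
  rw [Finsupp.mul_sum]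
  exact Finsupp.sum_congr fun e _ => by ring

/-- The score is monotone in the weight for nonnegative coefficient vectors. -/
theorem score_mono_weight {W₁ W₂ : ℤ → ℚ} {G : ℤ →₀ ℚ} (hG : ∀ e, 0 ≤ G e) (h : ∀ e, W₁ e ≤ W₂ e) :
    score W₁ G ≤ score W₂ G := by
  unfold score Finsupp.sum
  exact Finset.sum_le_sum fun e _ => mul_le_mul_of_nonneg_left (h e) (hG e)

/-- The score over a finite sum of weights. -/
theorem score_sum_weight {ι : Type} (s : Finset ι) (Ws : ι → ℤ → ℚ) (G : ℤ →₀ ℚ) :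
    score (fun e => ∑ i ∈ s, Ws i e) G = ∑ i ∈ s, score (Ws i) G := by
  classical
  induction s using Finset.induction_on with
  | empty => simp [score]
  | @insert i s hi ih =>
      rw [Finset.sum_insert hi, ← ih, ← score_add_weight]
      exact congrArg (fun W => score W G) (funext fun e => Finset.sum_insert hi)

/-- The CLASS WEIGHT of `r`: `2^e` on the residue class of `r`, `0` elsewhere. -/
noncomputable def classW (q : ℕ) (r : ℤ) (e : ℤ) : ℚ := if (q : ℤ) ∣ e - r then (2 : ℚ) ^ e else 0

/-- `classW ≥ 0`. -/
theorem classW_nonneg (q : ℕ) (r e : ℤ) : 0 ≤ classW q r e := by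
  unfold classW; split_ifs
  · exact (zpow_pos (by norm_num) e).le
  · exact le_rfl

/-- `classW ≤ 2^e`. -/
theorem classW_le (q : ℕ) (r e : ℤ) : classW q r e ≤ (2 : ℚ) ^ e := by
  unfold classW; split_ifs
  · exact le_rfl
  · exact (zpow_pos (by norm_num) e).le

/-- In a routable set the class weights of its members do not overlap: on the class of `r₀ ∈ R`
their sum is `2^e`, … -/
theorem sum_classW_of_dvd {q : ℕ} {R : Finset ℤ} (hR : Routable q R) {r₀ : ℤ} (hr₀ : r₀ ∈ R) {e : ℤ}
    (he : (q : ℤ) ∣ e - r₀) : ∑ r ∈ R, classW q r e = (2 : ℚ) ^ e := by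
  rw [Finset.sum_eq_single_of_mem r₀ hr₀]
  · unfold classW; rw [if_pos he]
  · intro r hr hne
    unfold classW
    rw [if_neg]
    intro h
    have : (q : ℤ) ∣ r₀ - r := by
      have := dvd_sub h he; rwa [show e - r - (e - r₀) = r₀ - r by ring] at this
    exact hne (eq_of_routable_of_dvd hR hr₀ hr this).symm

/-- … and off all their classes it is `0`. -/
theorem sum_classW_of_not {q : ℕ} {R : Finset ℤ} {e : ℤ} (he : ∀ r ∈ R, ¬ (q : ℤ) ∣ e - r) :
    ∑ r ∈ R, classW q r e = 0 :=
  Finset.sum_eq_zero fun r hr => by unfold classW; rw [if_neg (he r hr)]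

/-! ## Midpoint convexity -/

section MC

variable {q : ℕ}

/-- The core of (M)(ii) and (MC): with `S`, the run `β, …, β+j ⊆ S`, `β+j+1 ∉ S` and the carried
configuration `S⁺ = (S ∖ run) ∪ {β+j+1}` routable, BOTH `BR_t(S) ≤ BR_t(S⁺)` (the carry never loses)
and `2 · BR_t(S) ≤ BR_t(S⁺) + BR_t(S ∖ {β})`. -/
theorem treeBR_carry_core (t : SumTree) {S : Finset ℤ} (hS : Routable q S) {β : ℤ} {j : ℕ}
    (hrun : ∀ i : ℕ, i ≤ j → β + (i : ℤ) ∈ S) (hβ' : β + ((j : ℤ) + 1) ∉ S)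
    (hS' : Routable q (insert (β + ((j : ℤ) + 1))
      (S \ (Finset.range (j + 1)).image fun i : ℕ => β + (i : ℤ)))) :
    treeBR q t S ≤
        treeBR q t (insert (β + ((j : ℤ) + 1)) (S \ (Finset.range (j + 1)).image fun i : ℕ => β + (i : ℤ))) ∧
      2 * treeBR q t S ≤
        treeBR q t (insert (β + ((j : ℤ) + 1)) (S \ (Finset.range (j + 1)).image fun i : ℕ => β + (i : ℤ))) +
          treeBR q t (S.erase β) := by
  classical
  -- names
  set β' : ℤ := β + ((j : ℤ) + 1) with hβ'def
  set run : Finset ℤ := (Finset.range (j + 1)).image fun i : ℕ => β + (i : ℤ) with hrundef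
  have h2pos : ∀ e : ℤ, (0 : ℚ) < (2 : ℚ) ^ e := fun e => zpow_pos (by norm_num) e
  have hrunS : run ⊆ S := by
    intro r hr
    obtain ⟨i, hi, rfl⟩ := Finset.mem_image.1 hr
    exact hrun i (by rw [Finset.mem_range] at hi; omega)
  have hrunR : Routable q run := hS.mono hrunS
  have hβrun : β ∈ run := Finset.mem_image.2 ⟨0, by simp, by simp⟩
  have hβS : β ∈ S := hrunS hβrun
  have mem_run : ∀ {r : ℤ}, r ∈ run ↔ β ≤ r ∧ r ≤ β + j := by
    intro r
    rw [hrundef, Finset.mem_image]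
    constructor
    · rintro ⟨i, hi, rfl⟩; rw [Finset.mem_range] at hi; constructor <;> omega
    · rintro ⟨h1, h2⟩
      refine ⟨(r - β).toNat, ?_, ?_⟩
      · rw [Finset.mem_range]; omega
      · rw [Int.toNat_of_nonneg (by omega)]; ring
  -- an element of S between β and β' is in the run
  have run_of_between : ∀ e ∈ S, β ≤ e → e < β' → e ∈ run := fun e he h1 h2 =>
    mem_run.2 ⟨h1, by rw [hβ'def] at h2; omega⟩
  -- the supporting routing of S at the actual weight
  obtain ⟨G, hG, hGeq, hsupp⟩ := exists_isCoef_support (q := q) (W := fun e => (2 : ℚ) ^ e)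
    (fun e => (h2pos e).le) t hS
  have hG0 := isCoef_nonneg t S G hG
  -- class scores
  set T : ℤ → ℚ := fun r => score (classW q r) G with hTdef
  have hT0 : ∀ r, 0 ≤ T r := fun r => by
    rw [hTdef]; simp only
    have := score_mono_weight (W₁ := fun _ => 0) (W₂ := classW q r) hG0 (classW_nonneg q r)
    rwa [show score (fun _ => (0 : ℚ)) G = 0 by unfold score; simp] at this
  ---------------------------------------------------------------- (i) the lower neighbour
  have hlow : score (fun e => (2 : ℚ) ^ e) G - T β ≤ treeBR q t (S.erase β) := by
    set Wm : ℤ → ℚ := fun e => (2 : ℚ) ^ e - classW q β e with hWm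
    have hWm0 : ∀ e, 0 ≤ Wm e := fun e => by rw [hWm]; simp only; linarith [classW_le q β e]
    have hWmnull : ∀ e, ¬ ¬ (q : ℤ) ∣ e - β → Wm e = 0 := fun e he => by
      rw [hWm]; simp only; unfold classW; rw [if_pos (not_not.1 he)]; ring
    -- score at Wm
    have hsc : score Wm G = score (fun e => (2 : ℚ) ^ e) G - T β := by
      have := score_add_weight Wm (classW q β) G
      have e1 : (fun e => Wm e + classW q β e) = fun e => (2 : ℚ) ^ e := by
        funext e; rw [hWm]; simp only; ring
      rw [e1] at this; rw [hTdef]; simp only; linarith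
    -- Wm-value of S ≤ Wm-value of S.erase β = actual value
    have hdel := treeBRw_le_filter (q := q) (W := Wm) hWm0 (p := fun e => ¬ (q : ℤ) ∣ e - β)
      (fun e => by rw [dvd_sub_shift_iff]) hWmnull t S hS
    have hfil : S.filter (fun e => ¬ (q : ℤ) ∣ e - β) = S.erase β := by
      ext e
      simp only [Finset.mem_filter, Finset.mem_erase]
      constructor
      · rintro ⟨he, hne⟩; exact ⟨fun h => hne (by rw [h]; simp), he⟩
      · rintro ⟨hne, he⟩; exact ⟨he, fun h => hne (eq_of_routable_of_dvd hS he hβS h)⟩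
    rw [hfil] at hdel
    have hloc : treeBRw q Wm t (S.erase β) = treeBR q t (S.erase β) := by
      rw [treeBR]
      refine treeBRw_congr (p := fun e => ∃ s ∈ S.erase β, (q : ℤ) ∣ e - s)
        (fun e ⟨s, hs, h⟩ => ⟨s, hs, (dvd_sub_shift_iff _ _ _).2 h⟩) (fun e ⟨s, hs, h⟩ => ?_)
        t _ (fun e he => ⟨e, he, by simp⟩)
      rw [hWm]; simp only; unfold classW
      rw [if_neg, sub_zero]
      intro h'
      obtain ⟨hsβ, hsS⟩ := Finset.mem_erase.1 hs
      have : (q : ℤ) ∣ s - β := by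
        have := dvd_sub h' h; rwa [show e - β - (e - s) = s - β by ring] at this
      exact hsβ (eq_of_routable_of_dvd hS hsS hβS this)
    calc score (fun e => (2 : ℚ) ^ e) G - T β = score Wm G := hsc.symm
      _ ≤ treeBRw q Wm t S := hsupp Wm
      _ ≤ treeBRw q Wm t (S.erase β) := hdel
      _ = treeBR q t (S.erase β) := hloc
  ---------------------------------------------------------------- (ii) the upper neighbour, for each run member b
  have hup : ∀ b ∈ run, score (fun e => (2 : ℚ) ^ e) G - (∑ r ∈ run, T r) + (2 : ℚ) ^ (β' - b) * T b ≤
      treeBR q t (insert β' (S \ run)) := by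
    intro b hb
    have hbS : b ∈ S := hrunS hb
    obtain ⟨hbβ, hbj⟩ := mem_run.1 hb
    set d : ℤ := β' - b with hd
    -- the weight: actual off the run, the class of b paid at the rate of β', other run classes 0
    set Wb : ℤ → ℚ := fun e => (2 : ℚ) ^ e - (∑ r ∈ run, classW q r e) + (2 : ℚ) ^ d * classW q b e
      with hWb
    -- pointwise values of Wb
    have hWb_b : ∀ e, (q : ℤ) ∣ e - b → Wb e = (2 : ℚ) ^ (e + d) := fun e he => by
      rw [hWb]; simp only
      rw [sum_classW_of_dvd hrunR hb he]; unfold classW; rw [if_pos he, zpow_add₀ (by norm_num)]; ring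
    have hWb_run : ∀ e, ¬ (q : ℤ) ∣ e - b → (∃ r ∈ run, (q : ℤ) ∣ e - r) → Wb e = 0 := by
      rintro e he ⟨r, hr, her⟩
      rw [hWb]; simp only
      rw [sum_classW_of_dvd hrunR hr her]; unfold classW; rw [if_neg he]; ring
    have hWb_off : ∀ e, (∀ r ∈ run, ¬ (q : ℤ) ∣ e - r) → Wb e = (2 : ℚ) ^ e := fun e he => by
      rw [hWb]; simp only
      rw [sum_classW_of_not he]; unfold classW; rw [if_neg (he b hb)]; ring
    have hWb0 : ∀ e, 0 ≤ Wb e := by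
      intro e
      by_cases h1 : (q : ℤ) ∣ e - b
      · rw [hWb_b e h1]; exact (h2pos _).le
      · by_cases h2 : ∃ r ∈ run, (q : ℤ) ∣ e - r
        · rw [hWb_run e h1 h2]
        · rw [hWb_off e (fun r hr h => h2 ⟨r, hr, h⟩)]; exact (h2pos _).le
    -- its score
    have hsc : score Wb G = score (fun e => (2 : ℚ) ^ e) G - (∑ r ∈ run, T r) + (2 : ℚ) ^ d * T b := by
      have e1 : Wb = fun e => ((2 : ℚ) ^ e + (-1) * ∑ r ∈ run, classW q r e) + (2 : ℚ) ^ d * classW q b e := by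
        funext e; rw [hWb]; simp only; ring
      rw [e1, score_add_weight, score_add_weight, score_smul_weight, score_smul_weight, score_sum_weight]
      rw [hTdef]; simp only; ring
    -- the transplant of the class of b to the class of β'
    set S₀ : Finset ℤ := insert b (S \ run) with hS₀
    have hS₀S : S₀ ⊆ S := by
      intro x hx
      rcases Finset.mem_insert.1 hx with rfl | hx
      · exact hbS
      · exact (Finset.mem_sdiff.1 hx).1
    have hOK : TransplantOK q S₀ b d := by
      refine ⟨hS.mono hS₀S, Finset.mem_insert_self _ _, ?_, ?_, ?_⟩
      · rw [hd, show b + (β' - b) = β' by ring]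
        intro h
        rcases Finset.mem_insert.1 h with h | h
        · rw [hβ'def] at h; omega
        · exact hβ' (Finset.mem_sdiff.1 h).1
      · rw [hd, show b + (β' - b) = β' by ring]
        have : insert β' (S₀.erase b) = insert β' (S \ run) := by
          rw [hS₀, Finset.erase_insert]
          intro h; exact (Finset.mem_sdiff.1 h).2 hb
        rw [this]; exact hS'
      · intro e he hne
        rw [hd, show b + (β' - b) = β' by ring]
        rcases Finset.mem_insert.1 he with h | h
        · exact absurd h hne
        · obtain ⟨heS, her⟩ := Finset.mem_sdiff.1 h
          constructor
          · intro hlt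
            by_contra hge
            rcases eq_or_lt_of_le (not_lt.1 hge) with h' | h'
            · exact hβ' (h' ▸ heS)
            · exact her (run_of_between e heS (by omega) h')
          · intro hlt; rw [hβ'def] at hlt; omega
    -- InD facts: elements reachable from S₀ lie in the classes of S₀
    have hcls : ∀ x, InD q S₀ x → ((q : ℤ) ∣ x - b) ∨ (∀ r ∈ run, ¬ (q : ℤ) ∣ x - r) := by
      rintro x ⟨e, he, k, rfl⟩
      rcases Finset.mem_insert.1 he with rfl | he
      · exact Or.inl ⟨-(k : ℤ), by ring⟩
      · right
        obtain ⟨heS, her⟩ := Finset.mem_sdiff.1 he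
        intro r hr h
        have : (q : ℤ) ∣ e - r := by
          have := dvd_add h (dvd_mul_left (q : ℤ) (k : ℤ)); rwa [show e - k * q - r + k * q = e - r by ring] at this
        exact her ((eq_of_routable_of_dvd hS heS (hrunS hr) this) ▸ hr)
    have hWW : ∀ x, InD q S₀ x → Wb x ≤ (2 : ℚ) ^ (transplant q b d x) := by
      intro x hx
      unfold transplant
      rcases hcls x hx with h | h
      · rw [if_pos h, hWb_b x h]
      · rw [if_neg (h b hb), hWb_off x h]
    -- the image of S₀ is the carried configuration
    have himg : S₀.image (transplant q b d) = insert β' (S \ run) := by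
      rw [hS₀, Finset.image_insert]
      have e1 : transplant q b d b = β' := by unfold transplant; rw [if_pos (by simp), hd]; ring
      rw [e1]
      congr 1
      refine Finset.image_congr (g := id) (fun x hx => ?_) |>.trans Finset.image_id
      have hx' := Finset.mem_coe.1 hx
      obtain ⟨hxS, hxr⟩ := Finset.mem_sdiff.1 hx'
      unfold transplant
      rw [if_neg]
      · rfl
      · intro h; exact hxr ((eq_of_routable_of_dvd hS hxS hbS h) ▸ hb)
    have htr := treeBRw_le_transplant hOK (W := Wb) (W' := fun e => (2 : ℚ) ^ e) hWW t S₀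
      (fun x hx => inD_of_mem hx) (hS.mono hS₀S)
    rw [himg] at htr
    -- deletion: Wb-value of S ≤ Wb-value of S₀
    have hdel := treeBRw_le_filter (q := q) (W := Wb) hWb0
      (p := fun e => (q : ℤ) ∣ e - b ∨ ∀ r ∈ run, ¬ (q : ℤ) ∣ e - r)
      (fun e => by
        simp only [dvd_sub_shift_iff])
      (fun e he => by
        have h1 : ¬ (q : ℤ) ∣ e - b := fun h => he (Or.inl h)
        have h2 : ∃ r ∈ run, (q : ℤ) ∣ e - r := by
          by_contra h'
          exact he (Or.inr fun r hr h => h' ⟨r, hr, h⟩)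
        exact hWb_run e h1 h2) t S hS
    have hfil : S.filter (fun e => (q : ℤ) ∣ e - b ∨ ∀ r ∈ run, ¬ (q : ℤ) ∣ e - r) = S₀ := by
      ext e
      simp only [Finset.mem_filter, hS₀, Finset.mem_insert, Finset.mem_sdiff]
      constructor
      · rintro ⟨he, h | h⟩
        · exact Or.inl (eq_of_routable_of_dvd hS he hbS h)
        · exact Or.inr ⟨he, fun her => h e her (by simp)⟩
      · rintro (rfl | ⟨he, her⟩)
        · exact ⟨hbS, Or.inl (by simp)⟩
        · refine ⟨he, Or.inr fun r hr h => her ?_⟩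
          exact (eq_of_routable_of_dvd hS he (hrunS hr) h) ▸ hr
    rw [hfil] at hdel
    calc score (fun e => (2 : ℚ) ^ e) G - (∑ r ∈ run, T r) + (2 : ℚ) ^ d * T b = score Wb G := hsc.symm
      _ ≤ treeBRw q Wb t S := hsupp Wb
      _ ≤ treeBRw q Wb t S₀ := hdel
      _ ≤ treeBRw q (fun e => (2 : ℚ) ^ e) t (insert β' (S \ run)) := htr
      _ = treeBR q t (insert β' (S \ run)) := rfl
  ---------------------------------------------------------------- (iii) the best rate in the run
  obtain ⟨b, hb, hbmax⟩ := Finset.exists_max_image run (fun r => T r / (2 : ℚ) ^ r) ⟨β, hβrun⟩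
  have hupb := hup b hb
  set M := T b / (2 : ℚ) ^ b with hM
  have hM0 : 0 ≤ M := div_nonneg (hT0 b) (h2pos b).le
  -- Σ_run T r + T β ≤ 2^β' · M
  have hTr : ∀ r ∈ run, T r ≤ (2 : ℚ) ^ r * M := fun r hr => by
    have := hbmax r hr
    rw [div_le_iff₀ (h2pos r)] at this; linarith
  have hsumT : ∑ r ∈ run, T r ≤ ((2 : ℚ) ^ β' - (2 : ℚ) ^ β) * M := by
    calc ∑ r ∈ run, T r ≤ ∑ r ∈ run, (2 : ℚ) ^ r * M := Finset.sum_le_sum hTr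
      _ = (∑ r ∈ run, (2 : ℚ) ^ r) * M := by rw [Finset.sum_mul]
      _ = ((2 : ℚ) ^ β' - (2 : ℚ) ^ β) * M := by
          congr 1
          rw [hrundef, Finset.sum_image fun i _ i' _ h => by exact_mod_cast (add_left_cancel h : (i : ℤ) = i'),
            sum_run_pow β j]
  have hTβ : T β ≤ (2 : ℚ) ^ β * M := hTr β hβrun
  have hkey : (2 : ℚ) ^ (β' - b) * T b = (2 : ℚ) ^ β' * M := by
    rw [hM, zpow_sub₀ (by norm_num)]; field_simp
  rw [hkey] at hupb
  -- assemble
  have hsum2 : ∑ r ∈ run, T r ≤ (2 : ℚ) ^ β' * M := by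
    have : (0 : ℚ) ≤ (2 : ℚ) ^ β * M := mul_nonneg (h2pos β).le hM0
    linarith
  rw [treeBR, ← hGeq]
  constructor <;> linarith

/-- **THE CARRY NEVER LOSES ((M), case (ii) of opt gen 13 §4)**: with `β, …, β+j ∈ S`, `β+j+1 ∉ S`
and the carried configuration routable (the bits of `v + 2^β` for `β ∈ bits(v)`),
`BR_t(S) ≤ BR_t((S ∖ run) ∪ {β+j+1})`. -/
theorem treeBR_le_carry (t : SumTree) {S : Finset ℤ} (hS : Routable q S) {β : ℤ} {j : ℕ}
    (hrun : ∀ i : ℕ, i ≤ j → β + (i : ℤ) ∈ S) (hβ' : β + ((j : ℤ) + 1) ∉ S)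
    (hS' : Routable q (insert (β + ((j : ℤ) + 1))
      (S \ (Finset.range (j + 1)).image fun i : ℕ => β + (i : ℤ)))) :
    treeBR q t S ≤
      treeBR q t (insert (β + ((j : ℤ) + 1)) (S \ (Finset.range (j + 1)).image fun i : ℕ => β + (i : ℤ))) :=
  (treeBR_carry_core t hS hrun hβ' hS').1

/-- **MIDPOINT CONVEXITY IN BIT DIRECTIONS (MC)** (opt gen 13 §4; every tree, every precision).
`S` routable (the bits of a float `v`), `β ∈ S` with its maximal run `β, β+1, …, β+j ∈ S`,
`β+j+1 ∉ S`, and the carried configuration `(S ∖ run) ∪ {β+j+1}` (the bits of `v + 2^β`) routable: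
`2 · BR_t(S) ≤ BR_t((S ∖ run) ∪ {β+j+1}) + BR_t(S ∖ {β})`. -/
theorem treeBR_midconvex (t : SumTree) {S : Finset ℤ} (hS : Routable q S) {β : ℤ} {j : ℕ}
    (hrun : ∀ i : ℕ, i ≤ j → β + (i : ℤ) ∈ S) (hβ' : β + ((j : ℤ) + 1) ∉ S)
    (hS' : Routable q (insert (β + ((j : ℤ) + 1))
      (S \ (Finset.range (j + 1)).image fun i : ℕ => β + (i : ℤ)))) :
    2 * treeBR q t S ≤
      treeBR q t (insert (β + ((j : ℤ) + 1)) (S \ (Finset.range (j + 1)).image fun i : ℕ => β + (i : ℤ))) +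
        treeBR q t (S.erase β) :=
  (treeBR_carry_core t hS hrun hβ' hS').2

end MC

end Summit.Ventures.CertifiedArithmetic.LowPrec.Opt
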